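import Summits.QuantumFields.YangMills.Theorems.FluctuationComparisonRegPrIntLArgminOrbitOfUniqueCriticalOrbit
import Summits.QuantumFields.YangMills.Theorems.UnitScaleTiltHalvingP1FlatPillarWrapWitness
import Literature.MathematicalPhysics.QuantumFieldTheory.Balaban1983to89.B12CriticalPoint23
import HarnessLib

/-!
# THE FLAT CORNER OF GAP♯∘ BY KERNEL — REG-ARGMIN(V ≡ 1) AT EVERY DEPTH, hence ORB(V ≡ 1) from the Prop-7 letter alone (crux `FluctuationComparisonRegPrIntL`,
# stmt-QuantumFields-20520; registry v11.4 `Cruxes/FluctuationComparisonRegPrIntL/Lines/semiclassical_s2beta.lean` 3732b7df, organ GAP♯∘ `UniformFibreGapOrbit` l.768 — its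
# docstring's «cheapest falsifier: two distinct residual orbits of minimisers over V ≡ 1»; px17 g14 LOCATE-ORB e47193f2 §5, UV3-NODE §37)

Cell `ym3-torus` (YM ladder rung R3 = continuum `SU(2)` Yang–Mills on the three-torus — a RUNG, NOT d = 4, NOT infinite volume, NOT a mass gap, NOT Clay); width seat `ym3-torus-px17`
(gen 14); `--supports stmt-QuantumFields-20520 --as helper`, count-neutral, definition-free, default heartbeats.

WHAT.  ✓p784065 (sibling) reduced ORB «`argminHist V` is ONE residual orbit» to print's uniqueness letter PLUS the letter REG-ARGMIN(V) («every point of `argminHist V` is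
(6)-regular»), free only at bounded depth in general.  Over the FLAT datum `V ≡ 1` REG-ARGMIN holds at EVERY depth with no smallness at all: `minActionRegPr … ε₀ 1 = 0`
(lit ✓`minActionRegPr_one`), so a point of `argminHist 1` has zero Wilson action, hence is FLAT (every plaquette variable `= 1`: `1 − Re tr` vanishes termwise,
lit ✓`B12CriticalPoint23.eq_one_of_reTr_eq_one_specialUnitaryGroup`), hence satisfies `PlaqSmall δ` for EVERY `δ > 0`, hence both clauses of [7] (2) at any `ε₀ > 0`
(lit ✓`T3AvgDivergenceSplit.regPr_of_plaqSmall` at `δ := ε₀L^{−3(K−J)}/8`).  With the sibling's pointwise door, ORB(1) follows from [Balaban1985Variational] Prop. 7 clause 1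
(`Prop7AtMostOneCriticalOrbitAt L a₀ B₃`, at `ε₁ := ε₀/B₃`, `PlaqSmall ε₁ 1`) ALONE, for every `J ≤ K`, every profile and every coupling: the registry's «cheapest falsifier»
cannot fire at ANY depth modulo print's uniqueness letter.  Non-vacuity: `1 ∈ argminHist 1` (✓`one_mem_argmin_one`).

* §1 `plaqHol_eq_one_of_wilsonAction4_eq_zero'` (local copy of the `SU(N)` flatness fact), `flat_of_mem_argmin_one`, `regPr_of_flat`, ★`regArgmin_one` (REG-ARGMIN(1), every depth),
  `one_mem_argmin_one` (non-vacuity, over ✓`HalvingP1FlatPillarWrapWitness.iter_blockAvg_one`).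
* §2 ★★`argmin_one_eq_orbit_of_prop7At` — ORB(1) at every depth from `Prop7AtMostOneCriticalOrbitAt L a₀ B₃` (`0 < B₃`, `0 < ε₀ ≤ a₀`, `F.L = L`).

HONEST (CREDIT NOTHING): the flat corner only; says nothing about non-flat interior data, where REG-ARGMIN ≡ CLOSE∘ is the organ's unprinted content (UV3-NODE §37.3); the Prop-7
schema is a HYPOTHESIS; GAP♯∘, EXW∘, S2β, 20520, EX (19200) NOT proved; no summit is proved by a helper; rung R3 = SU(2) YM₃ on T³ — NOT d = 4, NOT infinite volume, NOT a mass gap,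
NOT Clay.  Sorry-free, axioms standard.

References: T. Bałaban, CMP **102** (1985) 277–309 [Balaban1985Variational] ((2), (6) p.278, Prop. 7 p.299); CMP **109** (1987) 249–301 [Balaban1987RG1] ((0.2) p.252, (0.4) p.253).
-/

set_option autoImplicit false

noncomputable section

namespace Summit.QuantumFields.YangMills.Theorems.FluctuationComparisonRegPrIntLRegArgminFlat

open Set
open Literature.MathematicalPhysics.QuantumFieldTheory.Balaban1983to89
open Literature.MathematicalPhysics.QuantumFieldTheory.Balaban1983to89.T3ContinuumYM3Torus
open Literature.MathematicalPhysics.QuantumFieldTheory.Balaban1983to89.T3UnitLawDensityEML (ℰp)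
open Literature.MathematicalPhysics.QuantumFieldTheory.Balaban1983to89.T3UnitScaleTilt
open Literature.MathematicalPhysics.QuantumFieldTheory.Balaban1983to89.T3TiltDescent
open Literature.MathematicalPhysics.QuantumFieldTheory.Balaban1983to89.T3ConstrainedMinimiser (fibre)
open Literature.MathematicalPhysics.QuantumFieldTheory.Balaban1983to89.T3DescentFibreTower
open Literature.MathematicalPhysics.QuantumFieldTheory.Balaban1983to89.T3RegularMinimiser
open Literature.MathematicalPhysics.QuantumFieldTheory.Balaban1983to89.T3PrintedRegularMinimiser
open Literature.MathematicalPhysics.QuantumFieldTheory.Balaban1983to89.T3Thm1Carrier (varProblem3)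
open Literature.MathematicalPhysics.QuantumFieldTheory.Balaban1983to89.T3Thm1UniquenessSchema (Prop7AtMostOneCriticalOrbitAt)
open Literature.MathematicalPhysics.QuantumFieldTheory.Balaban1983to89.T3MinimiserStabilityReduction (θBal_pos)
open Literature.MathematicalPhysics.QuantumFieldTheory.Balaban1983to89.T3AvgDivergenceSplit (regPr_of_plaqSmall)
open Literature.MathematicalPhysics.QuantumFieldTheory.Balaban1983to89.Missing
open Literature.MathematicalPhysics.QuantumFieldTheory.Balaban1983to89.T4Continuum
open Summit.QuantumFields.YangMills.Theorems.FluctuationComparisonRegPrIntLS2BetaResidualGauge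
open Summit.QuantumFields.YangMills.Theorems.FluctuationComparisonRegPrIntLArgminOrbitOfUniqueCriticalOrbit

/-! ## §1 REG-ARGMIN over the flat datum, at every depth -/

section Flat

variable (F : T3Family) {J K : ℕ} (hJK : J ≤ K) {γ b₀ p₀ ε₀ : ℝ}

/-- Zero Wilson action on `SU(2)` forces every plaquette variable to be `1` (`1 − Re tr U(∂p) ≥ 0` termwise; local copy of lit `B15Claim189PinNonVacuity`'s fact).
[cite: Balaban1987RG1, (0.2) p.252] -/
theorem plaqHol_eq_one_of_wilsonAction4_eq_zero' (U : GaugeField (F.P K) 0 (Matrix.specialUnitaryGroup (Fin 2) ℂ)) (hA : wilsonAction4 U = 0)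
    (p : Plaq (F.P K) 0) : GaugeField.plaqHol U p = 1 := by
  unfold wilsonAction4 wilsonAction at hA
  have hnn : ∀ q ∈ (Finset.univ : Finset (Plaq (F.P K) 0)), 0 ≤ 1 * (1 - reTr (GaugeField.plaqHol U q)) := fun q _ => by
    have := GaugeGroup.reTr_le_one (GaugeField.plaqHol U q)
    rw [one_mul]; linarith
  have hp := (Finset.sum_eq_zero_iff_of_nonneg hnn).1 hA p (Finset.mem_univ p)
  rw [one_mul, sub_eq_zero] at hp
  exact B12CriticalPoint23.eq_one_of_reTr_eq_one_specialUnitaryGroup _ hp.symm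

/-- **A POINT OF `argminHist 1` IS FLAT** (`ε₀ > 0`): its action is `minActionRegPr … ε₀ 1 = 0`. [cite: Balaban1985Variational, Thm 1 (8) p.279] -/
theorem flat_of_mem_argmin_one (hε₀ : 0 < ε₀) {U : GaugeField (F.P K) 0 (Matrix.specialUnitaryGroup (Fin 2) ℂ)}
    (hU : U ∈ {U' | U' ∈ fibre F ℰp J K hJK 1 ∧ U' ∈ histGood F ℰp (θBal F.L γ b₀ p₀) K J ∧
      wilsonAction4 U' = minActionRegPr F J K hJK ε₀ 1}) :
    ∀ p : Plaq (F.P K) 0, GaugeField.plaqHol U p = 1 := by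
  have hA : wilsonAction4 U = 0 := by rw [hU.2.2]; exact minActionRegPr_one F hε₀
  exact plaqHol_eq_one_of_wilsonAction4_eq_zero' F U hA

/-- **A FLAT FIELD IS (6)-REGULAR FOR EVERY `ε₀ > 0` AND EVERY DEPTH**: `PlaqSmall δ` for every `δ > 0`, so both clauses of [7] (2) via lit ✓`regPr_of_plaqSmall` at
`δ := ε₀L^{−3(K−J)}/8` (`δ ≤ ε₀L^{−2(K−J)}`, `4δ < ε₀L^{−3(K−J)}`). [cite: Balaban1985Variational, (2) p.278] -/
theorem regPr_of_flat (hε₀ : 0 < ε₀) {U : GaugeField (F.P K) 0 (Matrix.specialUnitaryGroup (Fin 2) ℂ)}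
    (hflat : ∀ p : Plaq (F.P K) 0, GaugeField.plaqHol U p = 1) : RegPr F J K ε₀ U := by
  have hL1 : (1 : ℝ) ≤ (F.L : ℝ) := by exact_mod_cast F.hL.2.le
  have hi0 : (0 : ℝ) < (F.L : ℝ)⁻¹ := inv_pos.mpr (by linarith)
  have hi1 : (F.L : ℝ)⁻¹ ≤ 1 := inv_le_one_of_one_le₀ hL1
  have h3 : 0 < ε₀ * ((F.L : ℝ)⁻¹) ^ (3 * (K - J)) := mul_pos hε₀ (pow_pos hi0 _)
  have hp : ((F.L : ℝ)⁻¹) ^ (3 * (K - J)) ≤ ((F.L : ℝ)⁻¹) ^ (2 * (K - J)) := pow_le_pow_of_le_one hi0.le hi1 (by omega)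
  have hsmall : PlaqSmall (ε₀ * ((F.L : ℝ)⁻¹) ^ (3 * (K - J)) / 8) U := fun p => by
    rw [hflat p, GaugeGroup.dist1_one]
    positivity
  refine regPr_of_plaqSmall F hsmall ?_ ?_
  · unfold regThreshold
    have := mul_le_mul_of_nonneg_left hp hε₀.le
    linarith
  · linarith

/-- ★ **REG-ARGMIN OVER THE FLAT DATUM, AT EVERY DEPTH** (`ε₀ > 0`; no smallness of `γ, b₀, p₀`, no bound on `K − J`): every point of `argminHist 1` is (6)-regular.
[cite: Balaban1985Variational, (2) and (6) p.278] -/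
theorem regArgmin_one (hε₀ : 0 < ε₀) :
    ∀ U' ∈ {U' | U' ∈ fibre F ℰp J K hJK 1 ∧ U' ∈ histGood F ℰp (θBal F.L γ b₀ p₀) K J ∧
      wilsonAction4 U' = minActionRegPr F J K hJK ε₀ 1}, RegPr F J K ε₀ U' :=
  fun _ hU => regPr_of_flat F hε₀ (flat_of_mem_argmin_one F hJK hε₀ hU)

/-- **NON-VACUITY**: `1 ∈ argminHist 1` whenever `0 < γ ≤ 1`, `0 < b₀`, `0 < ε₀` (`1 ∈ fibre 1` by lit ✓`one_mem_fibre_one`; every block average of `1` is `1` (✓`HalvingP1FlatPillarWrapWitness.iter_blockAvg_one`), so the history is good;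
`A(1) = 0 = minActionRegPr … 1`). [cite: Balaban1985Variational, Thm 1 (8) p.279] -/
theorem one_mem_argmin_one (hγ : 0 < γ) (hγ1 : γ ≤ 1) (hb : 0 < b₀) (hε₀ : 0 < ε₀) :
    (1 : GaugeField (F.P K) 0 (Matrix.specialUnitaryGroup (Fin 2) ℂ)) ∈
      {U' | U' ∈ fibre F ℰp J K hJK 1 ∧ U' ∈ histGood F ℰp (θBal F.L γ b₀ p₀) K J ∧
        wilsonAction4 U' = minActionRegPr F J K hJK ε₀ 1} := by
  refine ⟨one_mem_fibre_one F ℰp expMeanLogSU_E_one hJK, fun j _ => ?_, ?_⟩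
  · rw [HalvingP1FlatPillarWrapWitness.iter_blockAvg_one F K]
    exact plaqSmall_one (θBal_pos F.hL.2.le hγ hγ1 hb p₀ (K - j))
  · rw [minActionRegPr_one F hε₀]
    exact wilsonAction4_eq_zero_of_flat' F
where
  /-- `A(1) = 0`. [cite: Balaban1987RG1, (0.2) p.252] -/
  wilsonAction4_eq_zero_of_flat' (F : T3Family) {K : ℕ} :
      wilsonAction4 (1 : GaugeField (F.P K) 0 (Matrix.specialUnitaryGroup (Fin 2) ℂ)) = 0 := by
    unfold wilsonAction4 wilsonAction
    refine Finset.sum_eq_zero fun p _ => ?_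
    have hp : GaugeField.plaqHol (1 : GaugeField (F.P K) 0 (Matrix.specialUnitaryGroup (Fin 2) ℂ)) p = 1 := by
      show (1 : Matrix.specialUnitaryGroup (Fin 2) ℂ) * 1 * (1 : Matrix.specialUnitaryGroup (Fin 2) ℂ)⁻¹ * (1 : Matrix.specialUnitaryGroup (Fin 2) ℂ)⁻¹ = 1
      simp
    rw [hp, GaugeGroup.reTr_one, sub_self, mul_zero]

end Flat

/-! ## §2 ORB over the flat datum from the Prop-7 letter alone, at every depth -/

section Orb

/-- ★★ **ORB(V ≡ 1) AT EVERY DEPTH ⟸ [Balaban1985Variational] PROP. 7 CLAUSE 1 ALONE**: with `Prop7AtMostOneCriticalOrbitAt L a₀ B₃` (never asserted), `0 < B₃`, `0 < ε₀ ≤ a₀`, for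
every member `F` (`F.L = L`), EVERY `J ≤ K`, every profile `γ b₀ p₀`: `argminHist 1` is the residual orbit of any of its points.  (Prop. 7 at `n := J < K`, `ε₁ := ε₀/B₃`, the (7)-datum
`PlaqSmall ε₁ 1`; REG-ARGMIN(1) by §1; corner `J = K` by ✓`pairwise_of_self`.)  The registry's «cheapest falsifier» of GAP♯∘ cannot fire at any depth modulo print's uniqueness letter.
[cite: Balaban1985Variational, Prop. 7 p.299] -/
theorem argmin_one_eq_orbit_of_prop7At {L : ℕ} {a₀ B₃ : ℝ} (h7 : Prop7AtMostOneCriticalOrbitAt L a₀ B₃) (hB₃ : 0 < B₃)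
    (F : T3Family) (hFL : F.L = L) {J K : ℕ} (hJK : J ≤ K) {γ b₀ p₀ ε₀ : ℝ} (hε₀ : 0 < ε₀) (hε₀a : ε₀ ≤ a₀) :
    ∀ U₀ ∈ {U' | U' ∈ fibre F ℰp J K hJK 1 ∧ U' ∈ histGood F ℰp (θBal F.L γ b₀ p₀) K J ∧
        wilsonAction4 U' = minActionRegPr F J K hJK ε₀ 1},
      {U' | U' ∈ fibre F ℰp J K hJK 1 ∧ U' ∈ histGood F ℰp (θBal F.L γ b₀ p₀) K J ∧
          wilsonAction4 U' = minActionRegPr F J K hJK ε₀ 1} =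
        {U | ∃ w : Site (F.P K) 0 → Matrix.specialUnitaryGroup (Fin 2) ℂ,
          (∀ U' : GaugeField (F.P K) 0 (Matrix.specialUnitaryGroup (Fin 2) ℂ),
              descendTo F ℰp J K hJK (GaugeField.gaugeAct w U') = descendTo F ℰp J K hJK U') ∧
            U = GaugeField.gaugeAct w U₀} := by
  refine argmin_eq_orbit_of_pairwise F hJK 1 ?_
  rcases Nat.eq_or_lt_of_le hJK with hEq | hlt
  · subst hEq
    exact pairwise_of_self F J hJK 1
  · have hε₁ : 0 < ε₀ / B₃ := div_pos hε₀ hB₃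
    have hlo : B₃ * (ε₀ / B₃) ≤ ε₀ := by rw [mul_div_cancel₀ _ hB₃.ne']
    have hA := h7 F hFL J K hlt (ε₀ / B₃) ε₀ hε₁ hlo hε₀a 1 (plaqSmall_one hε₁)
    intro U₀ hU₀ U₁ hU₁
    exact exists_residual_eq_gaugeAct_of_atMostOneCriticalOrbit F hJK hε₀ hA hU₀ hU₁
      (regArgmin_one F hJK hε₀ U₀ hU₀) (regArgmin_one F hJK hε₀ U₁ hU₁)

/-- ★★ **THE SAME UNDER THE PROP-7 LETTER OF THE WINDOW THEOREMS** (`∀ L, Odd L → 1 < L → ∃ a₀ B₃ > 0, Prop7AtMostOneCriticalOrbitAt L a₀ B₃`): for every `L` there is `ε₁ > 0` such that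
for all `0 < ε₀ ≤ ε₁`, every member, every `J ≤ K`, every profile, ORB(1) — no coupling threshold, no depth bound. [cite: Balaban1985Variational, Prop. 7 p.299] -/
theorem argmin_one_eq_orbit_of_prop7
    (h7 : ∀ L : ℕ, Odd L → 1 < L → ∃ a₀ B₃ : ℝ, 0 < a₀ ∧ 0 < B₃ ∧ Prop7AtMostOneCriticalOrbitAt L a₀ B₃) :
    ∀ (L : ℕ), ∃ ε₁ : ℝ, 0 < ε₁ ∧ ∀ (ε₀ : ℝ), 0 < ε₀ → ε₀ ≤ ε₁ → ∀ (F : T3Family), F.L = L →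
      ∀ (J K : ℕ) (hJK : J ≤ K) (γ b₀ p₀ : ℝ),
        ∀ U₀ ∈ {U' | U' ∈ fibre F ℰp J K hJK 1 ∧ U' ∈ histGood F ℰp (θBal F.L γ b₀ p₀) K J ∧
            wilsonAction4 U' = minActionRegPr F J K hJK ε₀ 1},
          {U' | U' ∈ fibre F ℰp J K hJK 1 ∧ U' ∈ histGood F ℰp (θBal F.L γ b₀ p₀) K J ∧
              wilsonAction4 U' = minActionRegPr F J K hJK ε₀ 1} =
            {U | ∃ w : Site (F.P K) 0 → Matrix.specialUnitaryGroup (Fin 2) ℂ,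
              (∀ U' : GaugeField (F.P K) 0 (Matrix.specialUnitaryGroup (Fin 2) ℂ),
                  descendTo F ℰp J K hJK (GaugeField.gaugeAct w U') = descendTo F ℰp J K hJK U') ∧
                U = GaugeField.gaugeAct w U₀} := by
  intro L
  by_cases hLodd : Odd L ∧ 1 < L
  swap
  · refine ⟨1, one_pos, fun ε₀ _ _ F hFL => ?_⟩
    exact absurd (hFL ▸ F.hL) hLodd
  obtain ⟨a₀, B₃, ha₀, hB₃, h7L⟩ := h7 L hLodd.1 hLodd.2
  exact ⟨a₀, ha₀, fun ε₀ hε₀ hε₀a F hFL J K hJK γ b₀ p₀ => argmin_one_eq_orbit_of_prop7At h7L hB₃ F hFL hJK hε₀ hε₀a⟩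

end Orb

end Summit.QuantumFields.YangMills.Theorems.FluctuationComparisonRegPrIntLRegArgminFlat

end
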